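import Literature.Probability.Percolation.QuadCrossingContinuityOfBound
import HarnessLib

/-!
# Quad continuity for parallelograms, part 1: convex geometry of affine chart quads

Stub `stub_quadContinuity_parallelogram` (sub-goal of `stub_quadContinuity`) of line
`hitting-tournament` for crux `CardySelfRefinement.LagHandOff` (stmt-CriticalPhenomena-10268):
Schramm–Smirnov's Lemma 5.1 [SchrammSmirnov2011, Lemma 5.1] on `ℋ_ℂ` for PARALLELOGRAM quads
`p ↦ a + L (chartPt p)` (`L` an invertible real-linear map of `ℂ`), through the tame cases of
their Lemma 6.1 [SchrammSmirnov2011, Lemma 6.1] proved in the tree.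

This first part is elementary convex geometry, used to verify the tameness provisos of the
tree's Lemma 6.1 theorems for parallelograms (the "parallelogram case"):

* `infDist_le_of_affine` — along an affinely parametrised segment `t ↦ c + t v` starting at a
  point `c` of a compact convex set `S`, the distance to `S` is monotone;
* `le_infDist_add_infDist` — if every path in a convex set `C` between two compact subsets
  `S₀, S₂ ⊆ C` has diameter `≥ d`, then `d ≤ dist(z, S₀) + dist(z, S₂)` for `z ∈ C` (two-segment
  path);
* `exists_cut_of_convex` — the CUT POINT of the tree's case-(3) theorem
  (`real_symmDiff_crossedEvent_le_of_isPerturbationThree_of_tame_all`) for a straight free side: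
  a parameter `ζ` below which the side stays `d/2`-away from `S₀` and above which it stays
  `d/2`-away from `S₂`;
* `dist_le_one_mul_of_affine` — a straight side is `1`-chord–arc;
* `convex_image_of_affine` — affine images of convex sets (coordinate rectangles,
  `convex_Icc_reProdIm_Icc`) are convex.
-/

noncomputable section

open Set Metric Filter MeasureTheory
open scoped unitInterval Topology ENNReal
open Literature.Probability.Percolation Literature.Probability.LatticeModels
open Literature.Probability.Percolation.QuadCrossing Literature.Topology.PlaneTopology

namespace Summit.CriticalPhenomena.CardyFormulaZ2.Cruxes.LagHandOff.HittingTournament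

/-! ### Distance to a convex set along a segment -/

/-- Along the segment `t ↦ c + t v` issued from a point `c` of a compact convex set `S ⊆ ℂ`, the
distance to `S` is monotone in `t ∈ [0, 1]`: if `y ∈ S` is nearest to `c + t v` and `s = λ t`,
then `(1 - λ) c + λ y ∈ S` is within `λ · dist(c + tv, y)` of `c + s v`. -/
theorem infDist_le_of_affine {S : Set ℂ} (hSc : IsCompact S) (hS : Convex ℝ S) {x : I → ℂ}
    {c v : ℂ} (hx : ∀ t, x t = c + ((t : ℝ) : ℂ) * v) (hc : c ∈ S) {s t : I} (hst : s ≤ t) :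
    infDist (x s) S ≤ infDist (x t) S := by
  by_cases ht : (t : ℝ) = 0
  · have hs0 : (s : ℝ) = 0 := le_antisymm (ht ▸ (hst : (s : ℝ) ≤ t)) s.2.1
    rw [hx s, hx t, hs0, ht]
  have htpos : 0 < (t : ℝ) := lt_of_le_of_ne t.2.1 (Ne.symm ht)
  set lam : ℝ := (s : ℝ) / t with hlam
  have hlam0 : 0 ≤ lam := div_nonneg s.2.1 t.2.1
  have hlam1 : lam ≤ 1 := (div_le_one htpos).2 hst
  have hslam : (s : ℝ) = lam * t := by rw [hlam, div_mul_cancel₀ _ ht]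
  obtain ⟨y, hy, hdist⟩ := hSc.exists_infDist_eq_dist ⟨c, hc⟩ (x t)
  have hy' : (1 - lam) • c + lam • y ∈ S := hS hc hy (by linarith) hlam0 (by ring)
  rw [Complex.real_smul, Complex.real_smul] at hy'
  refine (infDist_le_dist_of_mem hy').trans ?_
  have hrepr : x s - (((1 - lam : ℝ) : ℂ) * c + ((lam : ℝ) : ℂ) * y) =
      ((lam : ℝ) : ℂ) * (x t - y) := by
    rw [hx s, hx t, hslam]; push_cast; ring
  rw [dist_eq_norm, hrepr, norm_mul, Complex.norm_real, Real.norm_eq_abs, abs_of_nonneg hlam0,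
    ← dist_eq_norm, ← hdist]
  calc lam * infDist (x t) S ≤ 1 * infDist (x t) S :=
        mul_le_mul_of_nonneg_right hlam1 infDist_nonneg
    _ = infDist (x t) S := one_mul _

/-- The reversed form of `infDist_le_of_affine`: along `t ↦ c + t v` ENDING at a point of the
compact convex set `S` (`c + v ∈ S`), the distance to `S` is antitone. -/
theorem infDist_anti_of_affine {S : Set ℂ} (hSc : IsCompact S) (hS : Convex ℝ S) {x : I → ℂ}
    {c v : ℂ} (hx : ∀ t, x t = c + ((t : ℝ) : ℂ) * v) (hc : c + v ∈ S) {s t : I} (hst : s ≤ t) :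
    infDist (x t) S ≤ infDist (x s) S := by
  have hx' : ∀ u, (fun u => x (σ u)) u = (c + v) + ((u : ℝ) : ℂ) * (-v) := fun u => by
    show x (σ u) = _
    rw [hx, unitInterval.coe_symm_eq]; push_cast; ring
  have h := infDist_le_of_affine hSc hS hx' hc (unitInterval.symm_le_symm.2 hst)
  simpa only [unitInterval.symm_symm] using h

/-! ### Two-segment paths -/

/-- If every path inside the convex set `C` from `S₀` to `S₂` (compact subsets of `C`) has
diameter at least `d`, then `d ≤ dist(z, S₀) + dist(z, S₂)` for every `z ∈ C`: join nearest
points `y₀ ∈ S₀`, `y₂ ∈ S₂` to `z` by straight segments. -/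
theorem le_infDist_add_infDist {S₀ S₂ C : Set ℂ} (hS₀c : IsCompact S₀) (hS₂c : IsCompact S₂)
    (hS₀ne : S₀.Nonempty) (hS₂ne : S₂.Nonempty) (hS₀C : S₀ ⊆ C) (hS₂C : S₂ ⊆ C)
    (hC : Convex ℝ C) {d : ℝ}
    (hdle : ∀ y₀ ∈ S₀, ∀ y₂ ∈ S₂, ∀ γ : Path y₀ y₂, range γ ⊆ C → d ≤ diam (range γ))
    {z : ℂ} (hz : z ∈ C) : d ≤ infDist z S₀ + infDist z S₂ := by
  obtain ⟨y₀, hy₀, hd₀⟩ := hS₀c.exists_infDist_eq_dist hS₀ne z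
  obtain ⟨y₂, hy₂, hd₂⟩ := hS₂c.exists_infDist_eq_dist hS₂ne z
  let γ : Path y₀ y₂ := (Path.segment y₀ z).trans (Path.segment z y₂)
  have hrange : range γ = segment ℝ y₀ z ∪ segment ℝ z y₂ := by
    rw [Path.trans_range, Path.range_segment, Path.range_segment]
  have hsub : range γ ⊆ C := by
    rw [hrange]
    exact union_subset (hC.segment_subset (hS₀C hy₀) hz) (hC.segment_subset hz (hS₂C hy₂))
  refine (hdle y₀ hy₀ y₂ hy₂ γ hsub).trans ?_
  rw [hrange]
  have h1 : diam (segment ℝ y₀ z) = dist z y₀ := by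
    rw [← convexHull_pair, convexHull_diam, diam_pair, dist_comm]
  have h2 : diam (segment ℝ z y₂) = dist z y₂ := by
    rw [← convexHull_pair, convexHull_diam, diam_pair]
  calc diam (segment ℝ y₀ z ∪ segment ℝ z y₂)
      ≤ diam (segment ℝ y₀ z) + dist z z + diam (segment ℝ z y₂) :=
        diam_union (right_mem_segment ℝ y₀ z) (left_mem_segment ℝ z y₂)
    _ = infDist z S₀ + infDist z S₂ := by rw [h1, h2, dist_self, add_zero, hd₀, hd₂]

/-! ### The cut point of a straight free side -/

/-- **The cut point.** Let `S₀, S₂ ⊆ C` be compact convex subsets of a convex set `C ⊆ ℂ` such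
that every path in `C` from `S₀` to `S₂` has diameter `≥ d ≥ 0`, and let `t ↦ x t = c + t v`
(`t ∈ [0,1]`) be a straight segment in `C` from a point of `S₂` (`t = 0`) to a point of `S₀`
(`t = 1`).  Then there is `ζ` such that `dist(x t, S₀) ≥ d/2` for `t ≤ ζ` and
`dist(x t, S₂) ≥ d/2` for `t ≥ ζ`: take `ζ` the largest parameter with `dist(x ζ, S₀) ≥ d/2`
(the first distance is antitone, the second is monotone, and they sum to `≥ d`). This is the cut
hypothesis of the tree's case-(3) form of [SchrammSmirnov2011, Lemma 6.1] for parallelograms. -/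
theorem exists_cut_of_convex {S₀ S₂ C : Set ℂ} (hS₀c : IsCompact S₀) (hS₂c : IsCompact S₂)
    (hS₀C : S₀ ⊆ C) (hS₂C : S₂ ⊆ C) (hC : Convex ℝ C) (hS₀ : Convex ℝ S₀) (hS₂ : Convex ℝ S₂)
    {d : ℝ} (hd : 0 ≤ d)
    (hdle : ∀ y₀ ∈ S₀, ∀ y₂ ∈ S₂, ∀ γ : Path y₀ y₂, range γ ⊆ C → d ≤ diam (range γ))
    {x : I → ℂ} {c v : ℂ} (hx : ∀ t, x t = c + ((t : ℝ) : ℂ) * v) (hx0 : x 0 ∈ S₂)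
    (hx1 : x 1 ∈ S₀) (hxC : ∀ t, x t ∈ C) :
    ∃ ζ : ℝ, (∀ t : I, (t : ℝ) ≤ ζ → d / 2 ≤ infDist (x t) S₀) ∧
      (∀ t : I, ζ ≤ (t : ℝ) → d / 2 ≤ infDist (x t) S₂) := by
  -- the two distance functions
  set f : I → ℝ := fun t => infDist (x t) S₀ with hf
  set g : I → ℝ := fun t => infDist (x t) S₂ with hg
  have hxc : Continuous x := by
    have : x = fun t : I => c + ((t : ℝ) : ℂ) * v := funext hx
    rw [this]; fun_prop
  have hfc : Continuous f := (continuous_infDist_pt (s := S₀)).comp hxc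
  have hgc : Continuous g := (continuous_infDist_pt (s := S₂)).comp hxc
  have hsum : ∀ t, d ≤ f t + g t := fun t =>
    le_infDist_add_infDist hS₀c hS₂c ⟨_, hx1⟩ ⟨_, hx0⟩ hS₀C hS₂C hC hdle (hxC t)
  have hc0 : c = x 0 := by rw [hx 0]; push_cast; ring
  have hc1 : c + v = x 1 := by rw [hx 1]; push_cast; ring
  -- `f` is antitone, `g` is monotone
  have hfanti : ∀ s t : I, s ≤ t → f t ≤ f s := fun s t hst =>
    infDist_anti_of_affine hS₀c hS₀ hx (hc1 ▸ hx1) hst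
  have hgmono : ∀ s t : I, s ≤ t → g s ≤ g t := fun s t hst =>
    infDist_le_of_affine hS₂c hS₂ hx (hc0 ▸ hx0) hst
  -- the cut: the largest parameter with `f ≥ d/2`
  set T : Set I := {t | d / 2 ≤ f t} with hT
  have hTc : IsClosed T := isClosed_le continuous_const hfc
  have h0T : (0 : I) ∈ T := by
    show d / 2 ≤ f 0
    have h := hsum 0
    have hg0 : g 0 = 0 := infDist_zero_of_mem hx0
    linarith
  have hTne : T.Nonempty := ⟨0, h0T⟩
  obtain ⟨ζ, hζ⟩ := hTc.isCompact.exists_isGreatest hTne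
  refine ⟨(ζ : ℝ), fun t ht => ?_, fun t ht => ?_⟩
  · exact le_trans hζ.1 (hfanti t ζ ht)
  · rcases eq_or_lt_of_le ht with heq | hlt
    · -- `t = ζ`: approach from the right, or `ζ = 1`
      have htζ : t = ζ := Subtype.ext heq.symm
      subst htζ
      by_cases h1 : (t : ℝ) = 1
      · have ht1 : t = 1 := Subtype.ext h1
        rw [ht1]
        have hf1 : f 1 = 0 := infDist_zero_of_mem hx1
        have := hsum 1
        show d / 2 ≤ g 1
        linarith
      · -- every `u > t` has `g u > d/2`; closedness of `{g ≥ d/2}` and `t ∈ closure (t, 1]`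
        have hlt1 : (t : ℝ) < 1 := lt_of_le_of_ne t.2.2 h1
        have hGc : IsClosed {u : I | d / 2 ≤ g u} := isClosed_le continuous_const hgc
        have hsub : Ioc t 1 ⊆ {u : I | d / 2 ≤ g u} := by
          intro u hu
          have huT : u ∉ T := fun huT => not_lt.2 (hζ.2 huT) hu.1
          have hfu : f u < d / 2 := not_le.1 huT
          show d / 2 ≤ g u
          linarith [hsum u]
        have hmem : t ∈ closure (Ioc t (1 : I)) := by
          rw [closure_Ioc (show t ≠ 1 from fun h => h1 (congrArg Subtype.val h))]
          exact ⟨le_rfl, unitInterval.le_one'⟩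
        exact hGc.closure_subset_iff.2 hsub hmem
    · have htT : t ∉ T := fun htT => not_lt.2 (hζ.2 htT) (show ζ < t from hlt)
      have hft : f t < d / 2 := not_le.1 htT
      show d / 2 ≤ g t
      linarith [hsum t]

/-! ### Straight sides are `1`-chord–arc -/

/-- A straight, affinely parametrised side `u ↦ y₀ + u w` is `1`-chord–arc at every scale:
if `dist(y s, y t) ≤ ρ` then every `y u` with `u` between `s` and `t` is within `ρ` of `y s`. -/
theorem dist_le_one_mul_of_affine {y : I → ℂ} {y₀ w : ℂ}
    (hy : ∀ u, y u = y₀ + ((u : ℝ) : ℂ) * w) (ρ : ℝ) (s t : I) (hst : dist (y s) (y t) ≤ ρ)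
    (u : I) (hu : (s : ℝ) ≤ u ∧ (u : ℝ) ≤ t ∨ (t : ℝ) ≤ u ∧ (u : ℝ) ≤ s) :
    dist (y u) (y s) ≤ 1 * ρ := by
  have hd : ∀ p q : I, dist (y p) (y q) = |(p : ℝ) - q| * ‖w‖ := fun p q => by
    rw [dist_eq_norm, hy p, hy q, show y₀ + ((p : ℝ) : ℂ) * w - (y₀ + ((q : ℝ) : ℂ) * w) =
      (((p : ℝ) - q : ℝ) : ℂ) * w by push_cast; ring, norm_mul, Complex.norm_real,
      Real.norm_eq_abs]
  rw [one_mul, hd]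
  rw [hd] at hst
  have hle : |(u : ℝ) - s| ≤ |(s : ℝ) - t| := by
    rcases hu with ⟨h1, h2⟩ | ⟨h1, h2⟩
    · rw [abs_of_nonneg (by linarith), abs_of_nonpos (by linarith)]; linarith
    · rw [abs_of_nonpos (by linarith), abs_of_nonneg (by linarith)]; linarith
  exact (mul_le_mul_of_nonneg_right hle (norm_nonneg _)).trans hst

/-! ### Convexity of affine images of coordinate rectangles -/

/-- The image of a convex set under an affine map `z ↦ a + L z` of the plane is convex. -/
theorem convex_image_of_affine {a : ℂ} {L : ℂ ≃L[ℝ] ℂ} {H : ℂ ≃ₜ ℂ} (hH : ∀ z, H z = a + L z)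
    {S : Set ℂ} (hS : Convex ℝ S) : Convex ℝ (H '' S) := by
  have h : H '' S = (fun x => a + x) '' ((L : ℂ →ₗ[ℝ] ℂ) '' S) := by
    rw [image_image]
    exact image_congr fun z _ => hH z
  rw [h]
  exact (hS.linear_image _).translate a

/-- An affine map `z ↦ a + L z` (`L` real-linear) acts on `x + yi` as
`a + x · L 1 + y · L i`. -/
theorem affine_apply_ofReal_add_ofReal_mul_I {a : ℂ} {L : ℂ ≃L[ℝ] ℂ} {H : ℂ ≃ₜ ℂ}
    (hH : ∀ z, H z = a + L z) (x y : ℝ) :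
    H ((x : ℂ) + (y : ℂ) * Complex.I) = a + (x : ℂ) * L 1 + (y : ℂ) * L Complex.I := by
  rw [hH]
  have h1 : (x : ℂ) + (y : ℂ) * Complex.I = x • (1 : ℂ) + y • Complex.I := by
    rw [Complex.real_smul, Complex.real_smul, mul_one]
  rw [h1, map_add, L.map_smul, L.map_smul, Complex.real_smul, Complex.real_smul]
  ring

/-! ### Registered form -/

/-- **Registered sub-stub `stub_quadContinuity_parallelogram_cut`** (part 1 of
`stub_quadContinuity_parallelogram`, line `hitting-tournament`): the cut point of a straight free
side between two convex opposite sides of a convex carrier — the `∃ ζ` proviso of the tree's tame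
case-(3) form of [SchrammSmirnov2011, Lemma 6.1], parallelogram case (`exists_cut_of_convex`). -/
theorem stub_quadContinuity_parallelogram_cut : ∀ (S₀ S₂ C : Set ℂ), IsCompact S₀ → IsCompact S₂ → S₀ ⊆ C → S₂ ⊆ C → Convex ℝ C → Convex ℝ S₀ → Convex ℝ S₂ → ∀ d : ℝ, 0 ≤ d → (∀ y₀ ∈ S₀, ∀ y₂ ∈ S₂, ∀ γ : Path y₀ y₂, Set.range γ ⊆ C → d ≤ Metric.diam (Set.range γ)) → ∀ (x : unitInterval → ℂ) (c v : ℂ), (∀ t, x t = c + ((t : ℝ) : ℂ) * v) → x 0 ∈ S₂ → x 1 ∈ S₀ → (∀ t, x t ∈ C) → ∃ ζ : ℝ, (∀ t : unitInterval, (t : ℝ) ≤ ζ → d / 2 ≤ Metric.infDist (x t) S₀) ∧ (∀ t : unitInterval, ζ ≤ (t : ℝ) → d / 2 ≤ Metric.infDist (x t) S₂) :=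
  fun _ _ _ hS₀c hS₂c hS₀C hS₂C hC hS₀ hS₂ _ hd hdle _ _ _ hx hx0 hx1 hxC =>
    exists_cut_of_convex hS₀c hS₂c hS₀C hS₂C hC hS₀ hS₂ hd hdle hx hx0 hx1 hxC

end Summit.CriticalPhenomena.CardyFormulaZ2.Cruxes.LagHandOff.HittingTournament

end
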